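import Summits.ResolutionOfSingularities.ResolutionOfSingularities.Theorems.PurelyInseparableDim4WinCertLeafKinds
import Summits.ResolutionOfSingularities.ResolutionOfSingularities.Theorems.PurelyInseparableDim4ScopeBlindGcdLeafCert
import HarnessLib
import HarnessLib.Audit.Tags

/-!
# Purely inseparable fourfolds — FCert v3 («LCert»): the leaf oracle `leafOK4` with FOUR landed leaf kinds at `p = 2` —
# substitution, norm, LAURENT (`laurentBlindB`) and GCD (`gcdLeafB`) — and its soundness
# [OURS · counted 0 · a certificate format for OUR frame v4, not about resolution]

Census cell «res-dim4-pi» (D-0157 DOOR 2), desk WORDS #111 (b) / #113 (d) / #118 (e); seat res-rescue-typ-3 g9.  Sequel of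
`…WinCertLeafKinds` (`leafOK2`: substitution + norm).  res-dim4-p-8 g3/g4 have since landed two further leaf lemmas with
𝔽_p certificates (one-owner line: the LEMMAS are p-8's, the row checker is this seat's):

* `laurentBlindB` / `not_inCoordinateScope_step_map_of_laurentBlindB` (`…ScopeBlindLaurent`, p686027): the RATIONAL-GRAPH
  leaf `{x_T = 0, a·x_m + c = 0, a ≠ 0}` via the substitution into `K[x][1/a]` — the lever of the ∀K residue measured by
  this seat (kit j322460: σ + Laurent leaves ⇒ 62 / 162 roots at budget 600, 53 of them ≤ 50 A-rows);
* `gcdLeafB` / `not_inCoordinateScope_step_map_of_gcdLeafB` (`…ScopeBlindGcdLeafCert`, p688080): the GCD leaf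
  `{x_T = 0, h = 0}` for any `h` dividing `J_q⁺|_{x_T = 0}` with trivial coordinate contents (Bézout data).
THIS FILE wires both into the kind-agnostic checker of `…WinCertLeafSound`: `LeafCert4 = subst | norm | laurent | gcd`, the
links between a leaf's closed / open conditions and each lemma's point hypotheses (`laurentLinkB`: `x_t ∈ gens`,
`a·x_m + c ∈ gens` and `a ∈ opens` up to collecting terms; `gcdLinkB`: `x_t ∈ gens`, `h ∈ gens`), the oracle **`leafOK4`**,
**`leafSound4 : LeafSound 2 leafOK4`**, and `forall_inScopeStateWins_of_lwinCertBL4`.  Nothing here proves resolution of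
singularities in dimension ≥ 4 / characteristic `p`; F4-C(2,2) stays OPEN; counted 0; AI work, weaker than expert review.
bears_on: LADDER-RESOLUTION:D157-DOOR2 (res-dim4-pi · F4-C ∀K column · FCert v3 leaf kinds). Supports stmt-ResolutionOfSingularities-16155 (helper).
-/

set_option linter.dupNamespace false

noncomputable section
open MvPolynomial Finset
open scoped BigOperators
namespace Summit.ResolutionOfSingularities.ResolutionOfSingularities.Theorems.PIDim4

namespace WinCertLeaf

open Literature.AlgebraicGeometry.Resolution
open Literature.AlgebraicGeometry.Resolution.CentreBlowup
open StepKit WinCertSound InScopeWinCert ScopeCover ScopeBlind WinCertAllFields WinCertFlat WinCertSubst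

/-! ## 1. The certificates of the four landed kinds -/

/-- A leaf certificate: substitution | norm | Laurent | GCD. [folklore] -/
inductive LeafCert4 (k : Type) where
  /-- p-8's substitution leaf `{b : σ(b) = b}` -/
  | subst (σ : Fin 4 → Terms 4 k) (T : Finset (Fin 4)) (α₀ : Fin 4 → ℕ) : LeafCert4 k
  /-- p-8's norm leaf (conjugate plane pair `x_T = 0`, `x_u² + x_u x_v + x_v² = 0`; `p = 2`) -/
  | norm (T : Finset (Fin 4)) (u v : Fin 4) (α₀ : Fin 4 → ℕ) : LeafCert4 k
  /-- p-8's Laurent leaf `x_T = 0`, `a·x_m + c = 0`, `a ≠ 0`, with division certificates `cert` -/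
  | laurent (T : Finset (Fin 4)) (m : Fin 4) (aL cL : Terms 4 k) (cert : (Fin 4 → ℕ) → ℕ × Terms 4 k)
      (α₀ : Fin 4 → ℕ) : LeafCert4 k
  /-- p-8's GCD leaf `x_T = 0`, `h = 0`, with cofactors `cof` and Bézout data `bez` -/
  | gcd (T : Finset (Fin 4)) (h : Terms 4 k) (cof : (Fin 4 → ℕ) → Terms 4 k)
      (bez : Fin 4 → List ((Fin 4 → ℕ) × Terms 4 k)) (α₀ : Fin 4 → ℕ) : LeafCert4 k

variable {k : Type} [Field k] [DecidableEq k]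

/-- **The link for a Laurent leaf**: `x_t ∈ gens` for `t ∈ T` other than the chart variable; `a·x_m + c ∈ gens` and
`a ∈ opens`, both up to collecting terms. [folklore] -/
def laurentLinkB {C : Type} (ℓ : ILeaf k C) (T : Finset (Fin 4)) (m : Fin 4) (aL cL : Terms 4 k) : Bool :=
  decide (∀ t ∈ T, t = ℓ.j ∨ ([(unitE t 1, (1 : k))] : Terms 4 k) ∈ ℓ.gens) &&
    decide (∃ g ∈ ℓ.gens, StepKit.equivB (normL g) (normL (mulL aL (varL m) ++ cL)) = true) &&
    decide (∃ o ∈ ℓ.opens, StepKit.equivB (normL o) (normL aL) = true)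

/-- **The link for a GCD leaf**: `x_t ∈ gens` for `t ∈ T` other than the chart variable, and `h ∈ gens` up to
collecting terms. [folklore] -/
def gcdLinkB {C : Type} (ℓ : ILeaf k C) (T : Finset (Fin 4)) (h : Terms 4 k) : Bool :=
  decide (∀ t ∈ T, t = ℓ.j ∨ ([(unitE t 1, (1 : k))] : Terms 4 k) ∈ ℓ.gens) &&
    decide (∃ g ∈ ℓ.gens, StepKit.equivB (normL g) (normL h) = true)

/-- **THE LEAF ORACLE at `p = 2`** for the four landed kinds. [folklore] -/
def leafOK4 (s : SData 4 (ZMod 2)) (S : Finset (Fin 4)) (ℓ : ILeaf (ZMod 2) (LeafCert4 (ZMod 2))) : Bool :=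
  match ℓ.cert with
  | .subst σ T α₀ => ℓ.opens.isEmpty && substLinkB ℓ σ && substBlindB 2 (chartL 2 S ℓ.j s.L) σ T α₀
  | .norm T u v α₀ => ℓ.opens.isEmpty && normLinkB ℓ T u v && normLeafB s S ℓ.j T u v α₀
  | .laurent T m aL cL cert α₀ => laurentLinkB ℓ T m aL cL && laurentBlindB 2 (chartL 2 S ℓ.j s.L) T m aL cL cert α₀
  | .gcd T h cof bez α₀ => gcdLinkB ℓ T h && gcdLeafB 2 (chartL 2 S ℓ.j s.L) T h cof bez α₀

/-! ## 2. Soundness of the links -/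

omit [DecidableEq k] in
/-- two term lists equal up to collecting terms have the same value at any point. [folklore] -/
theorem eval₂Hom_eq_of_equivB_normL {K : Type} [Field K] (f : k →+* K) (b : Fin 4 → K) {g h : Terms 4 k} [DecidableEq k]
    (he : StepKit.equivB (normL g) (normL h) = true) : eval₂Hom f b (evalT g) = eval₂Hom f b (evalT h) := by
  have : evalT g = evalT h := by
    rw [← evalT_normL g, ← evalT_normL h]
    exact (evalT_eq_iff_equivB _ _).mpr he
  rw [this]

omit [DecidableEq k] in
/-- the killed coordinates vanish at `b` (from the `x_t ∈ gens` part of a link). [folklore] -/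
theorem zero_of_coordLink {C : Type} {K : Type} [Field K] (f : k →+* K) {ℓ : ILeaf k C} {T : Finset (Fin 4)}
    [DecidableEq k] (hlink : ∀ t ∈ T, t = ℓ.j ∨ ([(unitE t 1, (1 : k))] : Terms 4 k) ∈ ℓ.gens) {b : Fin 4 → K}
    (hbj : b ℓ.j = 0) (hon : OnLeaf f ℓ b) : ∀ i ∈ T, b i = 0 := by
  intro i hi
  rcases hlink i hi with rfl | h
  · exact hbj
  · have hz := hon.1 _ h
    rwa [eval₂Hom_X_terms] at hz

omit [DecidableEq k] in
/-- From the Laurent link and the leaf conditions: `b_T = 0`, `a(b)·b_m + c(b) = 0`, `a(b) ≠ 0`. [folklore] -/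
theorem laurent_hyps_of_linkB {C : Type} {K : Type} [Field K] (f : k →+* K) {ℓ : ILeaf k C} {T : Finset (Fin 4)}
    {m : Fin 4} {aL cL : Terms 4 k} [DecidableEq k] (hlink : laurentLinkB ℓ T m aL cL = true) {b : Fin 4 → K}
    (hbj : b ℓ.j = 0) (hon : OnLeaf f ℓ b) :
    (∀ i ∈ T, b i = 0) ∧ MvPolynomial.eval b (MvPolynomial.map f (evalT aL)) ≠ 0 ∧
      MvPolynomial.eval b (MvPolynomial.map f (evalT aL)) * b m + MvPolynomial.eval b (MvPolynomial.map f (evalT cL)) = 0 := by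
  classical
  unfold laurentLinkB at hlink
  simp only [Bool.and_eq_true, decide_eq_true_eq] at hlink
  obtain ⟨⟨hT, ⟨g, hg, hge⟩⟩, ⟨o, ho, hoe⟩⟩ := hlink
  refine ⟨zero_of_coordLink f hT hbj hon, ?_, ?_⟩
  · have hne := hon.2 o ho
    rwa [eval₂Hom_eq_of_equivB_normL f b hoe, MvPolynomial.coe_eval₂Hom, ← MvPolynomial.eval_map] at hne
  · have hz := hon.1 g hg
    rw [eval₂Hom_eq_of_equivB_normL f b hge, evalT_append, evalT_mulL, evalT_varL, map_add, map_mul, eval₂Hom_X',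
      MvPolynomial.coe_eval₂Hom, ← MvPolynomial.eval_map, ← MvPolynomial.eval_map] at hz
    exact hz

omit [DecidableEq k] in
/-- From the GCD link and the leaf conditions: `b_T = 0` and `h(b) = 0`. [folklore] -/
theorem gcd_hyps_of_linkB {C : Type} {K : Type} [Field K] (f : k →+* K) {ℓ : ILeaf k C} {T : Finset (Fin 4)}
    {h : Terms 4 k} [DecidableEq k] (hlink : gcdLinkB ℓ T h = true) {b : Fin 4 → K} (hbj : b ℓ.j = 0)
    (hon : OnLeaf f ℓ b) :
    (∀ i ∈ T, b i = 0) ∧ MvPolynomial.eval b (MvPolynomial.map f (evalT h)) = 0 := by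
  classical
  unfold gcdLinkB at hlink
  simp only [Bool.and_eq_true, decide_eq_true_eq] at hlink
  obtain ⟨hT, ⟨g, hg, hge⟩⟩ := hlink
  refine ⟨zero_of_coordLink f hT hbj hon, ?_⟩
  have hz := hon.1 g hg
  rwa [eval₂Hom_eq_of_equivB_normL f b hge, MvPolynomial.coe_eval₂Hom, ← MvPolynomial.eval_map] at hz

/-- **SOUNDNESS OF THE ORACLE `leafOK4`.** [folklore] -/
theorem leafSound4 : LeafSound 2 leafOK4 := by
  classical
  intro s S ℓ hok K _ _ _ f b hbj hon
  obtain ⟨j, gens, opens, cert⟩ := ℓ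
  cases cert with
  | subst σ T α₀ =>
    simp only [leafOK4, Bool.and_eq_true] at hok
    obtain ⟨⟨-, hlink⟩, hsub⟩ := hok
    exact not_inCoordinateScope_step_map_of_substBlindB hsub K f b (eval_map_eq_of_substLinkB f hlink hbj hon)
  | norm T u v α₀ =>
    simp only [leafOK4, Bool.and_eq_true] at hok
    obtain ⟨⟨-, hlink⟩, hnorm⟩ := hok
    obtain ⟨hT, hQ⟩ := norm_hyps_of_normLinkB f hlink hbj hon
    have hf : f = ZMod.castHom (dvd_refl 2) K := Subsingleton.elim _ _
    subst hf
    exact children_blind_of_normLeafB hnorm K b hT hQ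
  | laurent T m aL cL cert α₀ =>
    simp only [leafOK4, Bool.and_eq_true] at hok
    obtain ⟨hlink, hlau⟩ := hok
    obtain ⟨hT, hab, hZ⟩ := laurent_hyps_of_linkB f hlink hbj hon
    exact not_inCoordinateScope_step_map_of_laurentBlindB hlau K f b hT hab hZ
  | gcd T h cof bez α₀ =>
    simp only [leafOK4, Bool.and_eq_true] at hok
    obtain ⟨hlink, hg⟩ := hok
    obtain ⟨hT, hh⟩ := gcd_hyps_of_linkB f hlink hbj hon
    exact not_inCoordinateScope_step_map_of_gcdLeafB hg K f b hT hh

/-- **`∀ K` form for the four kinds**: every row state of a certificate passing `lwinCertBL 2 2 leafOK4` is IN-SCOPE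
ESCAPABLE over every field of characteristic 2. [folklore] -/
theorem forall_inScopeStateWins_of_lwinCertBL4 {T : LCert (ZMod 2) (LeafCert4 (ZMod 2))}
    (h : lwinCertBL 2 2 leafOK4 T = true) (K : Type) [Field K] [CharP K 2] [DecidableEq K] :
    ∀ row ∈ T, InScopeStateWins 2
      (⟨MvPolynomial.map (ZMod.castHom (dvd_refl 2) K) row.1.1.toState.F, row.1.1.toState.r,
        row.1.1.toState.exc⟩ : State K) :=
  forall_inScopeStateWins_of_lwinCertBL leafSound4 h K

end WinCertLeaf

end Summit.ResolutionOfSingularities.ResolutionOfSingularities.Theorems.PIDim4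

end
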